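import Mathlib
import Literature.Analysis.InnerProduct.CourantFischerBounds
import Literature.Analysis.InnerProduct.CholeskyResidualEigenvalueBounds
import Literature.Analysis.InnerProduct.PoincareSeparation

/-!
# Venture YMGap, track Y3 FLOW-DATA — the SYMMETRY-BLOCK MERGE step of lineage A (flow-eng-1), typed

HONEST FRAMING: venture file of the cell `pub-ymgap` (QuantumFields programme), track Y3.  Finite linear
algebra only; nothing here is a statement about Yang–Mills, a continuum limit or a mass gap.

Lineage A (engine «sntm», HOME/pub-ymgap-flow-eng-1/ENGINE.md §2–§3) never assembles the kept-set Galerkin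
matrix `T` of a charge sector of the SU(2) Wilson transfer matrix: it builds, for every symmetry block
`i = (flux e, momentum p, character χ)`, the COMPRESSION `T_i = B_iᴴ T B_i` of `T` to the span of the
symmetrised orbit vectors (the columns of `B_i`, orthonormal), certifies enclosures of the largest eigenvalues
`λ↓₀(T_i) ≥ λ↓₁(T_i) ≥ …` of each block (the typed `RitzDeflationCertificate`), and then MERGES the blocks: a
row such as `E₁ = ln(λ₀/λ₀^{(e)})` uses «`λ₀^{(e)}` = max over ALL blocks of the sector `e` of the block top»
(row JSON field `sector`, flag `complete`), and the mass rows use «second level of the sector = max of the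
vacuum block's second level and every other block's top».  The two algebraic facts behind the merge are

* INVARIANCE `T B_i = B_i T_i` (the blocks are joint eigenspaces of symmetries commuting with `T`), and
* COMPLETENESS `Σ_i B_i B_iᴴ = 1` (the blocks exhaust the sector: every momentum / character class computed).

What is proved (theorems only; Mathlib's antitone `Matrix.IsHermitian.eigenvalues₀`):

* `sum_blocks_eq_of_invariant_complete` — invariance + completeness give the block resolution
  `T = Σ_i B_i T_i B_iᴴ`;
* `star_dotProduct_mulVec_eq_sum_blocks`, `sum_blocks_norm_sq` — the quadratic form and the norm split over
  the blocks: `x* T x = Σ_i y_i* T_i y_i`, `Σ_i ‖y_i‖² = ‖x‖²` with `y_i = B_iᴴ x`;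
* ★ `eigenvalues₀_le_of_blocks` (UPPER MERGE, any level): if `c` bounds level `k_i` of every block
  (`λ↓_{k_i}(T_i) ≤ c` whenever block `i` has more than `k_i` levels), then `λ↓_j(T) ≤ c` for every
  `j ≥ Σ_i k_i`.  With all `k_i = 0` this is `eigenvalues₀_le_of_blocks_top`: EVERY eigenvalue of the sector
  is at most the largest block top — the «max over all blocks» of the flux rows; with `k_{i₀} = 1` for the
  vacuum block and `k_i = 0` otherwise it bounds the sector's SECOND level by the max of the vacuum block's
  second level and the other blocks' tops — the mass rows;
* ★ `le_eigenvalues₀_of_blocks` (LOWER MERGE, any level): with orthonormal, mutually orthogonal blocks,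
  a common lower bound `σ` of the top `k_i` levels of the blocks bounds `λ↓_j(T)` from below for every
  `j + 1 ≤ Σ_i k_i` (the pushed-forward head eigenvectors are orthonormal eigenvectors of `T`;
  operator lemma `le_eigenvalues_of_orthonormal_eigenvectors`); `merged_level_enclosure` = both merges;
* `blocks_le_eigenvalues₀` (LOWER direction, one block): `λ↓_k(T_i) ≤ λ↓_j(T)` for `j ≤ k` — each certified
  block level bounds the same-index sector level from below (Poincaré separation along the isometry `B_i`;
  invariance is not even needed).

The same merge is what lineage B's space-group blocks need to pass from per-block spectra (typed in
`FlowData/EigenRadiusInvariantBlock.lean`: orthonormal eigenvectors of `S` spanning ONE invariant block) to the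
sector's levels; everything here is stated for exact matrices over `ℝ` or `ℂ`, so it serves either lineage.

The upper merge is the non-trivial direction (it FAILS without completeness: a forgotten block may carry the
top eigenvalue — exactly the caveat printed in the rows' `notes` for the `p ≠ 0` classes along `L > 2`
directions, which are not computed and hence not claimed).  Proof: Courant–Fischer (min–max half) against
the pushed-forward head eigenvectors `B_i u_{i,l}`, `l < k_i`, of the blocks, the per-block one-sided
Rayleigh bound `re ⟪T_i y, y⟫ ≤ λ↓_{k_i}(T_i) ‖y‖²` off those eigenvectors (tree:
`Literature.Analysis.InnerProduct.CourantFischerBounds`), and the two splitting identities.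
References: Horn–Johnson, *Matrix Analysis* (2nd ed.), Thm 4.2.6, Cor 4.3.37 [cite: HornJohnson2013];
the cell's ENGINE.md §2 (symmetry reduction) and `sntm/kit_build.py` (block loop), 2026-08-22/23.
-/

noncomputable section

open Matrix Finset WithLp Module
open scoped InnerProductSpace ComplexOrder BigOperators

namespace Summit.Ventures.YMGap.FlowData

namespace BlockMerge

open Literature.Analysis.InnerProduct

/-! ### §1 Operator lemmas -/

section Operator

variable {𝕜 : Type*} [RCLike 𝕜] {E : Type*} [NormedAddCommGroup E] [InnerProductSpace 𝕜 E]
  [FiniteDimensional 𝕜 E] {T : E →ₗ[𝕜] E} {n : ℕ}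

/-- **Min–max against an indexed constraint family.** If `re ⟪T x, x⟫ ≤ μ ‖x‖²` for every `x` orthogonal
to the vectors `v_p` (`p` ranging over a finite index type `κ`), then `λ_i ≤ μ` for every index `i ≥ |κ|`
of the antitone enumeration. [cite: HornJohnson2013, Cor 4.3.9] -/
theorem eigenvalues_le_of_forall_orthogonal_family (hT : T.IsSymmetric) (hn : finrank 𝕜 E = n)
    {κ : Type*} [Fintype κ] (v : κ → E) {μ : ℝ}
    (hμ : ∀ x : E, (∀ p, ⟪v p, x⟫_𝕜 = 0) → RCLike.re ⟪T x, x⟫_𝕜 ≤ μ * ‖x‖ ^ 2)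
    (i : Fin n) (hi : Fintype.card κ ≤ (i : ℕ)) : hT.eigenvalues hn i ≤ μ := by
  classical
  set V : Submodule 𝕜 E := Submodule.span 𝕜 (Set.range v) with hV
  have hVk : finrank 𝕜 V ≤ Fintype.card κ := by
    have h := finrank_range_le_card (R := 𝕜) v
    simpa [Set.finrank, hV] using h
  have hW : n ≤ finrank 𝕜 Vᗮ + i := by
    have h := V.finrank_add_finrank_orthogonal
    rw [hn] at h
    omega
  refine eigenvalues_le_of_forall_mem hT hn i Vᗮ hW fun x hx => hμ x fun p => ?_
  exact (Submodule.mem_orthogonal V x).1 hx (v p) (Submodule.subset_span ⟨p, rfl⟩)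

/-- **One-sided Rayleigh bound off the head of the spectrum, with a level budget.** If `y` is orthogonal to
the eigenvectors of the `kb` largest eigenvalues and `λ_{kb} ≤ c` (required only when `kb < n`; for
`kb ≥ n` the constraints force `y = 0`), then `re ⟪T y, y⟫ ≤ c ‖y‖²`. [cite: HornJohnson2013, Thm 4.2.6] -/
theorem re_inner_le_of_orthogonal_head (hT : T.IsSymmetric) (hn : finrank 𝕜 E = n) (kb : ℕ) {c : ℝ}
    (hc : ∀ h : kb < n, hT.eigenvalues hn ⟨kb, h⟩ ≤ c) {y : E}
    (hy : ∀ l : Fin n, (l : ℕ) < kb → ⟪hT.eigenvectorBasis hn l, y⟫_𝕜 = 0) :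
    RCLike.re ⟪T y, y⟫_𝕜 ≤ c * ‖y‖ ^ 2 := by
  by_cases h : kb < n
  · have h1 := re_inner_apply_self_le_of_inner_eq_zero hT hn ⟨kb, h⟩ (x := y)
      (fun l hl => hy l (Fin.lt_def.mp hl))
    exact h1.trans (mul_le_mul_of_nonneg_right (hc h) (sq_nonneg _))
  · have hy0 : y = 0 := by
      rw [← (hT.eigenvectorBasis hn).sum_repr' y]
      refine Finset.sum_eq_zero fun l _ => ?_
      have hl := l.isLt
      rw [hy l (by omega), zero_smul]
    subst hy0
    simp

/-- **Max–min against orthonormal eigenvectors.** If `w_p` (`p ∈ κ`) is an orthonormal family of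
eigenvectors of `T`, `T w_p = λ_p w_p`, and `σ ≤ λ_p` for every `p`, then `σ ≤ λ_j` for every index `j`
with `j + 1 ≤ |κ|` of the antitone enumeration (their span is a `|κ|`-dimensional subspace on which the
Rayleigh quotient is `≥ σ`). [cite: HornJohnson2013, Thm 4.2.6] -/
theorem le_eigenvalues_of_orthonormal_eigenvectors (hT : T.IsSymmetric) (hn : finrank 𝕜 E = n)
    {κ : Type*} [Fintype κ] {w : κ → E} (hw : Orthonormal 𝕜 w) {ev : κ → ℝ}
    (heig : ∀ p, T (w p) = (ev p : 𝕜) • w p) {σ : ℝ} (hσ : ∀ p, σ ≤ ev p)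
    (j : Fin n) (hj : (j : ℕ) + 1 ≤ Fintype.card κ) : σ ≤ hT.eigenvalues hn j := by
  classical
  refine le_eigenvalues_of_forall_mem hT hn j (Submodule.span 𝕜 (Set.range w))
    (by rw [finrank_span_eq_card hw.linearIndependent]; exact hj) fun x hx => ?_
  obtain ⟨c, rfl⟩ := (Submodule.mem_span_range_iff_exists_fun 𝕜).1 hx
  have hTx : T (∑ p, c p • w p) = ∑ p, (c p * (ev p : 𝕜)) • w p := by
    rw [map_sum]
    refine Finset.sum_congr rfl fun p _ => ?_
    rw [map_smul, heig p, smul_smul]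
  have hterm : ∀ p, (starRingEnd 𝕜) (c p * (ev p : 𝕜)) * c p = ((ev p * ‖c p‖ ^ 2 : ℝ) : 𝕜) := by
    intro p
    rw [map_mul, RCLike.conj_ofReal, mul_comm ((starRingEnd 𝕜) (c p)) _, mul_assoc, RCLike.conj_mul]
    push_cast
    ring
  have h2 : ‖∑ p, c p • w p‖ ^ 2 = ∑ p, ‖c p‖ ^ 2 := by
    rw [@norm_sq_eq_re_inner 𝕜, hw.inner_sum, map_sum]
    refine Finset.sum_congr rfl fun p _ => ?_
    rw [RCLike.conj_mul]
    norm_cast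
  rw [hTx, hw.inner_sum, map_sum, h2, Finset.mul_sum]
  refine Finset.sum_le_sum fun p _ => ?_
  rw [hterm p, RCLike.ofReal_re]
  exact mul_le_mul_of_nonneg_right (hσ p) (sq_nonneg _)

end Operator

/-! ### §2 Matrix forms: block resolution, splitting identities, the merge -/

section MatrixForms

variable {𝕜 : Type*} [RCLike 𝕜] {m ι : Type*} [Fintype m] [DecidableEq m] [Fintype ι]
  {n : ι → Type*} [∀ i, Fintype (n i)] [∀ i, DecidableEq (n i)]

omit [DecidableEq m] in
/-- Adjoint identity `(B u)* x = u* (Bᴴ x)`. [folklore] -/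
theorem star_mulVec_dotProduct {k : Type*} [Fintype k] (B : Matrix m k 𝕜) (u : k → 𝕜) (x : m → 𝕜) :
    star (B *ᵥ u) ⬝ᵥ x = star u ⬝ᵥ (Bᴴ *ᵥ x) := by
  rw [star_mulVec, ← dotProduct_mulVec]

omit [∀ i, DecidableEq (n i)] in
/-- **Block resolution.** Invariance `T B_i = B_i T_i` and completeness `Σ_i B_i B_iᴴ = 1` give
`T = Σ_i B_i T_i B_iᴴ`. [folklore] -/
theorem sum_blocks_eq_of_invariant_complete (T : Matrix m m 𝕜) (B : ∀ i, Matrix m (n i) 𝕜)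
    (Tb : ∀ i, Matrix (n i) (n i) 𝕜) (hinv : ∀ i, T * B i = B i * Tb i)
    (hcomp : ∑ i, B i * (B i)ᴴ = 1) : ∑ i, B i * Tb i * (B i)ᴴ = T := by
  calc ∑ i, B i * Tb i * (B i)ᴴ = ∑ i, T * (B i * (B i)ᴴ) := by
        refine Finset.sum_congr rfl fun i _ => ?_
        rw [← Matrix.mul_assoc, hinv i]
    _ = T := by rw [← Finset.mul_sum, hcomp, Matrix.mul_one]

omit [DecidableEq m] [∀ i, DecidableEq (n i)] in
/-- **Quadratic form splits over the blocks**: with `T = Σ_i B_i T_i B_iᴴ`,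
`x* T x = Σ_i (B_iᴴ x)* T_i (B_iᴴ x)`. [folklore] -/
theorem star_dotProduct_mulVec_eq_sum_blocks {T : Matrix m m 𝕜} (B : ∀ i, Matrix m (n i) 𝕜)
    (Tb : ∀ i, Matrix (n i) (n i) 𝕜) (hres : ∑ i, B i * Tb i * (B i)ᴴ = T) (x : m → 𝕜) :
    star x ⬝ᵥ (T *ᵥ x) = ∑ i, star ((B i)ᴴ *ᵥ x) ⬝ᵥ (Tb i *ᵥ ((B i)ᴴ *ᵥ x)) := by
  rw [← hres, Matrix.sum_mulVec, dotProduct_sum]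
  refine Finset.sum_congr rfl fun i _ => ?_
  rw [star_mulVec_dotProduct, conjTranspose_conjTranspose, ← mulVec_mulVec, ← mulVec_mulVec]

omit [∀ i, DecidableEq (n i)] in
/-- **Norm splits over the blocks**: completeness `Σ_i B_i B_iᴴ = 1` gives `Σ_i ‖B_iᴴ x‖² = ‖x‖²`
(as `Σ_i (B_iᴴ x)* (B_iᴴ x) = x* x`). [folklore] -/
theorem sum_blocks_norm_sq (B : ∀ i, Matrix m (n i) 𝕜) (hcomp : ∑ i, B i * (B i)ᴴ = 1)
    (x : m → 𝕜) : ∑ i, star ((B i)ᴴ *ᵥ x) ⬝ᵥ ((B i)ᴴ *ᵥ x) = star x ⬝ᵥ x := by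
  calc ∑ i, star ((B i)ᴴ *ᵥ x) ⬝ᵥ ((B i)ᴴ *ᵥ x) = ∑ i, star x ⬝ᵥ ((B i * (B i)ᴴ) *ᵥ x) := by
        refine Finset.sum_congr rfl fun i _ => ?_
        rw [star_mulVec_dotProduct, conjTranspose_conjTranspose, mulVec_mulVec]
    _ = star x ⬝ᵥ x := by rw [← dotProduct_sum, ← Matrix.sum_mulVec, hcomp, one_mulVec]

/-- ★ **UPPER MERGE (any level).** Let `T` (a sector's Galerkin matrix) be Hermitian, `B_i` the block
isometries with INVARIANCE `T B_i = B_i T_i` (`T_i` Hermitian) and COMPLETENESS `Σ_i B_i B_iᴴ = 1`.  If a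
real `c` bounds level `k_i` of every block — `λ↓_{k_i}(T_i) ≤ c` whenever block `i` has more than `k_i`
levels (no condition on exhausted blocks) — then `λ↓_j(T) ≤ c` for every level `j ≥ Σ_i k_i` of the sector.
This is the «max over ALL blocks» step of lineage A's rows (`k_i = 0`: flux rows; one `k_{i₀} = 1`: mass
rows), valid exactly under the completeness the row JSON records as `complete = True`.
[cite: HornJohnson2013, Thm 4.2.6] -/
theorem eigenvalues₀_le_of_blocks {T : Matrix m m 𝕜} (hT : T.IsHermitian) (B : ∀ i, Matrix m (n i) 𝕜)
    {Tb : ∀ i, Matrix (n i) (n i) 𝕜} (hTb : ∀ i, (Tb i).IsHermitian)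
    (hinv : ∀ i, T * B i = B i * Tb i) (hcomp : ∑ i, B i * (B i)ᴴ = 1) (kb : ι → ℕ) {c : ℝ}
    (hc : ∀ i, ∀ h : kb i < Fintype.card (n i), (hTb i).eigenvalues₀ ⟨kb i, h⟩ ≤ c)
    (j : Fin (Fintype.card m)) (hj : ∑ i, kb i ≤ (j : ℕ)) : hT.eigenvalues₀ j ≤ c := by
  classical
  have hS : (toEuclideanLin T).IsSymmetric := isSymmetric_toEuclideanLin_iff.mpr hT
  have hSb : ∀ i, (toEuclideanLin (Tb i)).IsSymmetric := fun i =>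
    isSymmetric_toEuclideanLin_iff.mpr (hTb i)
  change hS.eigenvalues finrank_euclideanSpace j ≤ c
  -- the constraint family: pushed-forward head eigenvectors `B_i u_{i,l}`, `l < k_i`
  let u : ∀ i, Fin (Fintype.card (n i)) → EuclideanSpace 𝕜 (n i) := fun i l =>
    (hSb i).eigenvectorBasis finrank_euclideanSpace l
  let κ := Σ i : ι, {l : Fin (Fintype.card (n i)) // (l : ℕ) < kb i}
  let v : κ → EuclideanSpace 𝕜 m := fun p => toLp 2 (B p.1 *ᵥ ofLp (u p.1 p.2.1))
  have hcard : Fintype.card κ ≤ (j : ℕ) := by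
    refine le_trans ?_ hj
    rw [Fintype.card_sigma]
    refine Finset.sum_le_sum fun i _ => ?_
    have hinj : Function.Injective
        (fun l : {l : Fin (Fintype.card (n i)) // (l : ℕ) < kb i} => (⟨l.1, l.2⟩ : Fin (kb i))) := by
      intro a b hab
      exact Subtype.ext (Fin.ext (by simpa using congrArg Fin.val hab))
    simpa using Fintype.card_le_of_injective _ hinj
  refine eigenvalues_le_of_forall_orthogonal_family hS finrank_euclideanSpace v ?_ j hcard
  intro x hx
  -- block components `y_i = B_iᴴ x`
  let y : ∀ i, EuclideanSpace 𝕜 (n i) := fun i => toLp 2 ((B i)ᴴ *ᵥ ofLp x)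
  have hblk : ∀ i, RCLike.re (star ((B i)ᴴ *ᵥ ofLp x) ⬝ᵥ (Tb i *ᵥ ((B i)ᴴ *ᵥ ofLp x)))
      ≤ c * ‖y i‖ ^ 2 := by
    intro i
    have h1 : RCLike.re ⟪toEuclideanLin (Tb i) (y i), y i⟫_𝕜 ≤ c * ‖y i‖ ^ 2 := by
      refine re_inner_le_of_orthogonal_head (hSb i) finrank_euclideanSpace (kb i) (hc i) fun l hl => ?_
      have h0 := hx ⟨i, ⟨l, hl⟩⟩
      rw [EuclideanSpace.inner_eq_star_dotProduct, dotProduct_comm] at h0 ⊢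
      change star (B i *ᵥ ofLp (u i l)) ⬝ᵥ ofLp x = 0 at h0
      change star (ofLp (u i l)) ⬝ᵥ ((B i)ᴴ *ᵥ ofLp x) = 0
      rwa [star_mulVec_dotProduct] at h0
    rwa [(hSb i) (y i) (y i), inner_self_toEuclideanLin] at h1
  have hnorm : ∑ i, ‖y i‖ ^ 2 = ‖x‖ ^ 2 := by
    have h := sum_blocks_norm_sq B hcomp (ofLp x)
    have h' : ∑ i, (((‖y i‖ ^ 2 : ℝ)) : 𝕜) = ((‖x‖ ^ 2 : ℝ) : 𝕜) := by
      rw [← star_dotProduct_self_euclidean x, ← h]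
      exact Finset.sum_congr rfl fun i _ => (star_dotProduct_self_euclidean (y i)).symm
    exact_mod_cast h'
  rw [hS x x, inner_self_toEuclideanLin,
    star_dotProduct_mulVec_eq_sum_blocks B Tb (sum_blocks_eq_of_invariant_complete T B Tb hinv hcomp)
      (ofLp x), map_sum]
  calc ∑ i, RCLike.re (star ((B i)ᴴ *ᵥ ofLp x) ⬝ᵥ (Tb i *ᵥ ((B i)ᴴ *ᵥ ofLp x)))
      ≤ ∑ i, c * ‖y i‖ ^ 2 := Finset.sum_le_sum fun i _ => hblk i
    _ = c * ‖x‖ ^ 2 := by rw [← Finset.mul_sum, hnorm]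

/-- **UPPER MERGE, top level**: under invariance and completeness EVERY eigenvalue of the sector is at most
any common upper bound `c` of the block tops `λ↓₀(T_i)` — «`λ₀^{(e)}` = max over all blocks of sector `e`»
in the flux rows `E₁`, `E1_axis1`, `E₂` of lineage A. [cite: HornJohnson2013, Thm 4.2.6] -/
theorem eigenvalues₀_le_of_blocks_top {T : Matrix m m 𝕜} (hT : T.IsHermitian)
    (B : ∀ i, Matrix m (n i) 𝕜) {Tb : ∀ i, Matrix (n i) (n i) 𝕜} (hTb : ∀ i, (Tb i).IsHermitian)
    (hinv : ∀ i, T * B i = B i * Tb i) (hcomp : ∑ i, B i * (B i)ᴴ = 1) {c : ℝ}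
    (hc : ∀ i, ∀ h : 0 < Fintype.card (n i), (hTb i).eigenvalues₀ ⟨0, h⟩ ≤ c)
    (j : Fin (Fintype.card m)) : hT.eigenvalues₀ j ≤ c :=
  eigenvalues₀_le_of_blocks hT B hTb hinv hcomp (fun _ => 0) hc j (by simp)

omit [Fintype ι] in
/-- **LOWER direction, one block**: along an isometric block `B_iᴴ B_i = 1` with `T B_i = B_i T_i`, every
block level bounds the same-index sector level from below, `λ↓_k(T_i) ≤ λ↓_j(T)` for `j ≤ k` (Poincaré
separation: `T_i = B_iᴴ T B_i` is a compression; completeness is not needed).  With the block's certified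
LOWER Ritz bound `σ ≤ λ↓_k(T_i)` this is the lower endpoint of the merged sector level.
[cite: HornJohnson2013, Cor 4.3.37] -/
theorem blocks_le_eigenvalues₀ {T : Matrix m m 𝕜} (hT : T.IsHermitian) {i : ι} (Bi : Matrix m (n i) 𝕜)
    (hiso : Biᴴ * Bi = 1) {Ti : Matrix (n i) (n i) 𝕜} (hTi : Ti.IsHermitian) (hinv : T * Bi = Bi * Ti)
    (k : Fin (Fintype.card (n i))) (j : Fin (Fintype.card m)) (hjk : (j : ℕ) ≤ k) {σ : ℝ}
    (hσ : σ ≤ hTi.eigenvalues₀ k) : σ ≤ hT.eigenvalues₀ j := by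
  have hcomp : Biᴴ * T * Bi = Ti := by rw [Matrix.mul_assoc, hinv, ← Matrix.mul_assoc, hiso, Matrix.one_mul]
  exact hσ.trans (eigenvalues₀_conjTranspose_mul_mul_le hT Bi hiso hcomp hTi k j hjk)

/-- ★ **LOWER MERGE (any level).** Let the block isometries be orthonormal and mutually orthogonal
(`B_iᴴ B_i = 1`, `B_iᴴ B_{i'} = 0` for `i ≠ i'` — distinct symmetry classes) with invariance
`T B_i = B_i T_i`.  If `σ` is a lower bound for the top `k_i` levels of every block (`σ ≤ λ↓_l(T_i)` for
`l < k_i`, `k_i ≤` the block size), then `σ ≤ λ↓_j(T)` for every level `j` with `j + 1 ≤ Σ_i k_i`: the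
pushed-forward head eigenvectors `B_i u_{i,l}` are `Σ_i k_i` orthonormal eigenvectors of `T` with eigenvalues
`≥ σ`.  With the blocks' certified LOWER Ritz bounds this is the lower endpoint of the merged sector levels
(e.g. «second level of the vacuum sector ≥ min(vacuum top, top of the block carrying the gap state)»).
Completeness is not needed for this direction. [cite: HornJohnson2013, Thm 4.2.6] -/
theorem le_eigenvalues₀_of_blocks {T : Matrix m m 𝕜} (hT : T.IsHermitian) (B : ∀ i, Matrix m (n i) 𝕜)
    {Tb : ∀ i, Matrix (n i) (n i) 𝕜} (hTb : ∀ i, (Tb i).IsHermitian)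
    (hinv : ∀ i, T * B i = B i * Tb i) (hiso : ∀ i, (B i)ᴴ * B i = 1)
    (horth : ∀ i i', i ≠ i' → (B i)ᴴ * B i' = 0) (kb : ι → ℕ)
    (hkb : ∀ i, kb i ≤ Fintype.card (n i)) {σ : ℝ}
    (hσ : ∀ i (l : Fin (Fintype.card (n i))), (l : ℕ) < kb i → σ ≤ (hTb i).eigenvalues₀ l)
    (j : Fin (Fintype.card m)) (hj : (j : ℕ) + 1 ≤ ∑ i, kb i) : σ ≤ hT.eigenvalues₀ j := by
  classical
  have hS : (toEuclideanLin T).IsSymmetric := isSymmetric_toEuclideanLin_iff.mpr hT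
  have hSb : ∀ i, (toEuclideanLin (Tb i)).IsSymmetric := fun i =>
    isSymmetric_toEuclideanLin_iff.mpr (hTb i)
  change σ ≤ hS.eigenvalues finrank_euclideanSpace j
  let u : ∀ i, Fin (Fintype.card (n i)) → EuclideanSpace 𝕜 (n i) := fun i l =>
    (hSb i).eigenvectorBasis finrank_euclideanSpace l
  let κ := Σ i : ι, Fin (kb i)
  let idx : ∀ p : κ, Fin (Fintype.card (n p.1)) := fun p => Fin.castLE (hkb p.1) p.2
  let w : κ → EuclideanSpace 𝕜 m := fun p => toLp 2 (B p.1 *ᵥ ofLp (u p.1 (idx p)))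
  have hcard : Fintype.card κ = ∑ i, kb i := by simp [κ, Fintype.card_sigma]
  -- Gram matrix of the pushed-forward family
  have hinner : ∀ p q : κ, ⟪w p, w q⟫_𝕜 =
      star (ofLp (u p.1 (idx p))) ⬝ᵥ (((B p.1)ᴴ * B q.1) *ᵥ ofLp (u q.1 (idx q))) := by
    intro p q
    rw [EuclideanSpace.inner_eq_star_dotProduct, dotProduct_comm]
    change star (B p.1 *ᵥ ofLp (u p.1 (idx p))) ⬝ᵥ (B q.1 *ᵥ ofLp (u q.1 (idx q))) = _
    rw [star_mulVec_dotProduct, mulVec_mulVec]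
  have hw : Orthonormal 𝕜 w := by
    rw [orthonormal_iff_ite]
    rintro ⟨i, l⟩ ⟨i', l'⟩
    rw [hinner]
    by_cases h : i = i'
    · subst h
      rw [hiso, one_mulVec, dotProduct_comm, ← EuclideanSpace.inner_eq_star_dotProduct]
      have hon := orthonormal_iff_ite.1 ((hSb i).eigenvectorBasis finrank_euclideanSpace).orthonormal
        (idx ⟨i, l⟩) (idx ⟨i, l'⟩)
      change ⟪u i (idx ⟨i, l⟩), u i (idx ⟨i, l'⟩)⟫_𝕜 = _ at hon
      rw [hon]
      by_cases hl : l = l'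
      · subst hl
        simp
      · have h1 : idx ⟨i, l⟩ ≠ idx ⟨i, l'⟩ := fun h => hl (Fin.castLE_injective (hkb i) h)
        have h2 : (⟨i, l⟩ : κ) ≠ ⟨i, l'⟩ := fun h => hl (by simpa using h)
        rw [if_neg h1, if_neg h2]
    · have h2 : (⟨i, l⟩ : κ) ≠ ⟨i', l'⟩ := fun hh => h (congrArg Sigma.fst hh)
      rw [horth i i' h, zero_mulVec, dotProduct_zero, if_neg h2]
  -- they are eigenvectors of `T` with the blocks' eigenvalues
  have heig : ∀ p : κ, toEuclideanLin T (w p) =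
      (((hSb p.1).eigenvalues finrank_euclideanSpace (idx p) : ℝ) : 𝕜) • w p := by
    rintro ⟨i, l⟩
    have hu : Tb i *ᵥ ofLp (u i (idx ⟨i, l⟩)) =
        (((hSb i).eigenvalues finrank_euclideanSpace (idx ⟨i, l⟩) : ℝ) : 𝕜) • ofLp (u i (idx ⟨i, l⟩)) := by
      have h := congrArg ofLp ((hSb i).apply_eigenvectorBasis finrank_euclideanSpace (idx ⟨i, l⟩))
      rw [WithLp.ofLp_smul] at h
      exact h
    apply (WithLp.ofLp_injective 2).eq_iff.mp ?_
    change T *ᵥ (B i *ᵥ ofLp (u i (idx ⟨i, l⟩))) = _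
    rw [mulVec_mulVec, hinv i, ← mulVec_mulVec, hu, mulVec_smul]
    rfl
  refine le_eigenvalues_of_orthonormal_eigenvectors hS finrank_euclideanSpace hw heig
    (fun p => hσ p.1 (idx p) (by simp [idx])) j (hcard ▸ hj)

/-- ★ **MERGED SECTOR-LEVEL ENCLOSURE** (the row shape).  Under invariance, block orthonormality and
completeness, level `j` of the never-assembled sector matrix `T` is enclosed by block data alone:
`σ ≤ λ↓_j(T) ≤ c` whenever `σ` is below the top `k_i` levels of the blocks for some budget with
`Σ_i k_i ≥ j + 1` (lower merge) and `c` is above level `k'_i` of every block for some budget with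
`Σ_i k'_i ≤ j` (upper merge).  Level `0`: `k' ≡ 0`, `k_{i₀} = 1` for a block attaining the top; level `1`
(mass rows): `k'_{vac} = 1`, and `k` = two head levels anywhere.  The block levels themselves are enclosed
by `RitzDeflation.block_enclosure` / `bracketed_block_enclosure`, whose endpoints are what a row carries.
[cite: HornJohnson2013, Thm 4.2.6] -/
theorem merged_level_enclosure {T : Matrix m m 𝕜} (hT : T.IsHermitian) (B : ∀ i, Matrix m (n i) 𝕜)
    {Tb : ∀ i, Matrix (n i) (n i) 𝕜} (hTb : ∀ i, (Tb i).IsHermitian)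
    (hinv : ∀ i, T * B i = B i * Tb i) (hiso : ∀ i, (B i)ᴴ * B i = 1)
    (horth : ∀ i i', i ≠ i' → (B i)ᴴ * B i' = 0) (hcomp : ∑ i, B i * (B i)ᴴ = 1)
    (j : Fin (Fintype.card m)) {σ c : ℝ}
    (kl : ι → ℕ) (hkl : ∀ i, kl i ≤ Fintype.card (n i))
    (hσ : ∀ i (l : Fin (Fintype.card (n i))), (l : ℕ) < kl i → σ ≤ (hTb i).eigenvalues₀ l)
    (hjl : (j : ℕ) + 1 ≤ ∑ i, kl i)
    (ku : ι → ℕ) (hc : ∀ i, ∀ h : ku i < Fintype.card (n i), (hTb i).eigenvalues₀ ⟨ku i, h⟩ ≤ c)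
    (hju : ∑ i, ku i ≤ (j : ℕ)) :
    σ ≤ hT.eigenvalues₀ j ∧ hT.eigenvalues₀ j ≤ c :=
  ⟨le_eigenvalues₀_of_blocks hT B hTb hinv hiso horth kl hkl hσ j hjl,
    eigenvalues₀_le_of_blocks hT B hTb hinv hcomp ku hc j hju⟩

end MatrixForms

end BlockMerge

end Summit.Ventures.YMGap.FlowData
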